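import Literature.IUT.LogThetaLattice.DHodgeTheaterRepIso
import Literature.IUT.LogThetaLattice.PrimeStripGroupoids
import Mathlib.CategoryTheory.Groupoid

/-!
# The representative-level groupoid of `𝒟-Θ^{±ell}`-Hodge theaters and its strip projections ([IUTchI] Def 6.4 (iii); [IUTchIII] Prop 1.3)

Mochizuki, *Inter-universal Teichmüller Theory I*, kurims manuscript (May 2020), §6, Def 6.4 (i)–(iii)
pp. 162–163; *III*, kurims (May 2020), Prop 1.3 (i)(ii) p. 42, Rmk 1.3.1 p. 43, Thm 1.5 (i) p. 48.
([IUTchI] Def 6.4 (iii) p.163) [claim: Mochizuki2012, status: disputed]. MERGE BRIDGE (plan/L6/MERGE-MAP.md §8 B10 part 2,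
`StripFrame.ofKits`, HT half, `𝒟`-level), consumer seat abc-iut-L6-t3 over abc-iut-L5-t4's `PMBaseBridges.lean`
(`PMBaseKit.DThetaPMEllHT`, `.Iso`) and abc-iut-L6-t7's `PrimeStripGroupoids.lean` (the groupoid of
`𝒟`-prime-strips, `Hom := DStrip.Iso`). Nothing of the series is asserted; nothing of L5-t4/L6-t7 is restated.

Contents.
* `DHTRep K` — the `𝒟-Θ^{±ell}`-Hodge theaters over the kit `K` (a type synonym of `K.DThetaPMEllHT`) as a
  GROUPOID whose morphisms are the representatives `DHTRep.DRepIso` of `DHodgeTheaterRepIso.lean`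
  (composition `DRepIso.trans`, identity `DRepIso.refl`, inverse `DRepIso.symm`); this is the shape of the
  field `StripFrame.DHT` of [IUTchIII] §1's frame (`PrimeStripFrame.lean`: a category of `𝒟`-Hodge theaters
  whose (iso)morphisms are SINGLE isomorphisms `Ξ`, [IUTchIII] Rmk 1.3.1).
* `DRepIso.toIso` — every representative DETERMINES an isomorphism of `𝒟-Θ^{±ell}`-Hodge theaters in the
  printed, poly-level sense typed by abc-iut-L5-t4 (`DThetaPMEllHT.Iso`: `+`-full orbits, `Aut_csp`-orbit, the
  same index bijection and the same capsule poly-isomorphism for both bridges). A printed isomorphism `Ξ`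
  thus corresponds to the poly-isomorphism "all representatives of `Ξ`" of `DHTRep K`.
* `DRepIso.ofModels` / `iso_nonempty` — any two `𝒟-Θ^{±ell}`-Hodge theaters are isomorphic (both are isomorphs
  of the model of Examples 6.2, 6.3: field `exists_model`) — the `StripFrame.iso_nonempty_DHT` shape
  ([IUTchI] Rmk 6.12.2 (ii): all such Hodge theaters are isomorphic).
* `codFunctor : DHTRep K ⥤ K.DStrip` (`†ℋ𝒯 ↦ †𝔇_≻`) and `globFunctor : DHTRep K ⥤ K.Glob` (`†ℋ𝒯 ↦ †𝒟^{⊚±}`) —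
  the `StripFrame.dstrip ≻` shape: the constituent prime-strip of a `𝒟`-Hodge theater, FUNCTORIALLY in
  single isomorphisms ([IUTchIII] Prop 1.3 (i) "the poly-isomorphism determined by `Ξ` between the
  `𝒟`-prime-strips associated to `†𝔉_□`, `‡𝔉_□`"; Thm 1.5 (i)).
The `Θ^{±ell}NF` layer (Def 6.13; the ΘNF-gluing) and the `ℱ`-level lift (Cor 5.3 (ii)) follow over
abc-iut-L5-t4's `ThetaPMEllHodgeTheaters` once it lands.
-/

namespace Literature.IUT.LogThetaLattice

open CategoryTheory
open Literature.IUT.HodgeTheaters Literature.IUT.HodgeTheaters.PMBaseKit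

universe u

variable {l : ℕ} {K : PMBaseKit.{u} l}

/-- **IUTchI:Def6.4(iii)** (kurims p.163) The `𝒟-Θ^{±ell}`-Hodge theaters over the kit `K` ([IUTchI] Def 6.4 (iii)), as the objects
of the REPRESENTATIVE-LEVEL groupoid (morphisms `DHTRep.DRepIso`). A type synonym of abc-iut-L5-t4's
`PMBaseKit.DThetaPMEllHT`. ([IUTchI] Def 6.4 (iii) p.163) [claim: Mochizuki2012, status: disputed] -/
def DHTRep (K : PMBaseKit.{u} l) : Type (max 1 u) := K.DThetaPMEllHT

namespace DHTRep

/-- **IUTchI:Def6.4(iii)** (kurims p.163) A `𝒟-Θ^{±ell}`-Hodge theater as an object of `DHTRep K`. ([IUTchI] Def 6.4 (iii) p.163) [claim: Mochizuki2012, status: disputed] -/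
def of (H : K.DThetaPMEllHT) : DHTRep K := H

/-- **IUTchI:Def6.4(iii)** (kurims p.163) The underlying `𝒟-Θ^{±ell}`-Hodge theater of an object of `DHTRep K`. ([IUTchI] Def 6.4 (iii) p.163) [claim: Mochizuki2012, status: disputed] -/
def out (X : DHTRep K) : K.DThetaPMEllHT := X

/-- **IUTchI:Def6.4(iii)** (kurims p.163) `out ∘ of = id` (bookkeeping for the type synonym). ([IUTchI] Def 6.4 (iii) p.163) [claim: Mochizuki2012, status: disputed] -/
@[simp] theorem out_of (H : K.DThetaPMEllHT) : (of H).out = H := rfl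

namespace DRepIso

variable {H₁ H₂ H₃ H₄ : K.DThetaPMEllHT}

/-! ### Groupoid laws for representatives -/

/-- **IUTchI:Def6.4(i)** (kurims p.162) Left identity for the "evident notion of composition". ([IUTchI] Def 6.4 (i) p.162) [claim: Mochizuki2012, status: disputed] -/
theorem refl_trans (f : DRepIso H₁ H₂) : (refl H₁).trans f = f :=
  DRepIso.ext rfl (heq_of_eq (funext fun _ => funext fun _ => Iso.refl_trans _)) (funext fun _ => Iso.refl_trans _)
    (Iso.refl_trans _)

/-- **IUTchI:Def6.4(i)** (kurims p.162) Right identity. ([IUTchI] Def 6.4 (i) p.162) [claim: Mochizuki2012, status: disputed] -/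
theorem trans_refl (f : DRepIso H₁ H₂) : f.trans (refl H₂) = f :=
  DRepIso.ext rfl (heq_of_eq (funext fun _ => funext fun _ => Iso.trans_refl _)) (funext fun _ => Iso.trans_refl _)
    (Iso.trans_refl _)

/-- **IUTchI:Def6.4(i)** (kurims p.162) Associativity. ([IUTchI] Def 6.4 (i) p.162) [claim: Mochizuki2012, status: disputed] -/
theorem trans_assoc (f : DRepIso H₁ H₂) (g : DRepIso H₂ H₃) (h : DRepIso H₃ H₄) :
    (f.trans g).trans h = f.trans (g.trans h) :=
  DRepIso.ext rfl (heq_of_eq (funext fun _ => funext fun _ => Iso.trans_assoc _ _ _))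
    (funext fun _ => Iso.trans_assoc _ _ _) (Iso.trans_assoc _ _ _)

/-- **IUTchI:Def6.4(iii)** (kurims p.163) The inverse representative is a left inverse. ([IUTchI] Def 6.4 (iii) p.163) [claim: Mochizuki2012, status: disputed] -/
theorem symm_trans (f : DRepIso H₁ H₂) : f.symm.trans f = refl H₂ := by
  refine ext_of_caps (Equiv.symm_trans_self f.ι) (fun t' v => ?_) (funext fun v => Iso.symm_self_id _)
    (Iso.symm_self_id _)
  show (((capsCast H₂ (f.ι.apply_symm_apply t').symm).trans (f.caps (f.ι.symm t')).symm).trans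
      (f.caps (f.ι.symm t')) v).hom ≫ eqToHom _ = (DStrip.Iso.refl (H₂.capsule t') v).hom
  simp [DStrip.Iso.trans, DStrip.Iso.symm, DStrip.Iso.refl, capsCast]

/-- **IUTchI:Def6.4(iii)** (kurims p.163) The inverse representative is a right inverse (formal consequence of the left-inverse law
for `f` and for `f.symm`). ([IUTchI] Def 6.4 (iii) p.163) [claim: Mochizuki2012, status: disputed] -/
theorem trans_symm (f : DRepIso H₁ H₂) : f.trans f.symm = refl H₁ := by
  have h2 : f.symm.symm = f := by
    calc f.symm.symm = f.symm.symm.trans (refl H₂) := (trans_refl _).symm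
      _ = f.symm.symm.trans (f.symm.trans f) := by rw [symm_trans]
      _ = (f.symm.symm.trans f.symm).trans f := (trans_assoc _ _ _).symm
      _ = (refl H₁).trans f := by rw [symm_trans]
      _ = f := refl_trans f
  nth_rewrite 1 [← h2]
  exact symm_trans f.symm

end DRepIso

/-! ### The groupoid -/

/-- **IUTchI:Def6.4(iii)** (kurims p.163) **The representative-level groupoid of `𝒟-Θ^{±ell}`-Hodge theaters**: morphisms are the
representatives `DRepIso` (single isomorphisms at every constituent, compatible with the bridge
poly-morphisms), composed constituentwise; every morphism is invertible. This is the `DHT`-shape consumed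
by [IUTchIII] §1 (`StripFrame.DHT`, `StripFrame.catDHT`). ([IUTchI] Def 6.4 (iii) p.163) [claim: Mochizuki2012, status: disputed] -/
instance groupoid : Groupoid.{u} (DHTRep K) where
  Hom X Y := DRepIso X.out Y.out
  id X := DRepIso.refl X.out
  comp f g := f.trans g
  id_comp f := DRepIso.refl_trans f
  comp_id f := DRepIso.trans_refl f
  assoc f g h := DRepIso.trans_assoc f g h
  inv f := f.symm
  inv_comp f := DRepIso.symm_trans f
  comp_inv f := DRepIso.trans_symm f

/-- **IUTchI:Def6.4(iii)** (kurims p.163) Morphisms of `DHTRep K` ARE representatives. ([IUTchI] Def 6.4 (iii) p.163) [claim: Mochizuki2012, status: disputed] -/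
theorem hom_eq (X Y : DHTRep K) : (X ⟶ Y) = DRepIso X.out Y.out := rfl

/-- **IUTchI:Def6.4(i)** (kurims p.162) Composition in `DHTRep K` IS `DRepIso.trans`. ([IUTchI] Def 6.4 (i) p.162) [claim: Mochizuki2012, status: disputed] -/
theorem comp_eq {X Y Z : DHTRep K} (f : X ⟶ Y) (g : Y ⟶ Z) : f ≫ g = DRepIso.trans f g := rfl

/-- **IUTchI:Def6.4(iii)** (kurims p.163) The identity of `DHTRep K` IS `DRepIso.refl`. ([IUTchI] Def 6.4 (iii) p.163) [claim: Mochizuki2012, status: disputed] -/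
theorem id_eq (X : DHTRep K) : 𝟙 X = DRepIso.refl X.out := rfl

/-! ### Every representative is a printed (poly-level) isomorphism -/

namespace DRepIso

variable {H₁ H₂ : K.DThetaPMEllHT}

/-- **IUTchI:Def6.4(i)** (kurims p.162) The isomorphism of `𝒟-Θ^±`-bridges (abc-iut-L5-t4's poly-level record) determined by a
representative: index bijection `ι`, capsule-`+`-full poly-isomorphism = the `Aut_+`-orbits of the `caps t`, `+`-full
poly-isomorphism `†𝔇_≻ ⥲ ‡𝔇_≻` = the orbit of `cod`. ([IUTchI] Def 6.4 (i) p.162) [claim: Mochizuki2012, status: disputed] -/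
def toPMIso (f : DRepIso H₁ H₂) : DThetaPMBridge.Iso H₁.pmBridge H₂.pmBridge where
  indexEquiv := f.ι
  indexEquiv_charts := f.ι_charts
  capsPoly t := DStrip.plusFullPolyIso (f.caps t)
  capsPoly_plusFull _ := ⟨_, rfl⟩
  codPoly := DStrip.plusFullPolyIso f.cod
  codPoly_plusFull := ⟨_, rfl⟩
  compat := f.compatPM

/-- **IUTchI:Def6.4(ii)** (kurims p.163) The isomorphism of `𝒟-Θ^{ell}`-bridges determined by a representative: the same index bijection
(an isomorphism of `𝔽_l^±`-groups is one of the induced `𝔽_l^±`-torsors), the same capsule orbits, and "an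
`Aut_csp(‡𝒟^{⊚±})`-orbit of isomorphisms" = the orbit of `glob`. ([IUTchI] Def 6.4 (ii) p.163) [claim: Mochizuki2012, status: disputed] -/
def toEllIso (f : DRepIso H₁ H₂) : DThetaEllBridge.Iso H₁.ellBridge H₂.ellBridge where
  indexEquiv := f.ι
  indexEquiv_charts := by
    rintro e ⟨e₂, he₂, g, rfl⟩
    exact ⟨f.ι.trans e₂, f.ι_charts e₂ he₂, g, (Equiv.trans_assoc _ _ _).symm⟩
  capsPoly t := DStrip.plusFullPolyIso (f.caps t)
  capsPoly_plusFull _ := ⟨_, rfl⟩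
  globPoly := {ψ | ∃ c ∈ K.autCsp H₂.glob, ψ = f.glob ≪≫ c}
  globPoly_orbit := ⟨f.glob, rfl⟩
  compat t v := by
    show {h | ∃ p ∈ DStrip.plusFullPolyIso (f.caps t), ∃ g ∈ H₂.polyEll (f.ι t) v, h = (p v).hom ≫ g} =
      {h | ∃ e ∈ H₁.polyEll t v, ∃ q ∈ {ψ | ∃ c ∈ K.autCsp H₂.glob, ψ = f.glob ≪≫ c},
        h = e ≫ (K.atV v).map (q : H₁.glob ≅ H₂.glob).hom}
    rw [f.compatEll t v]
    ext h
    simp only [Set.mem_setOf_eq]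
    constructor
    · rintro ⟨e, he, c, hc, rfl⟩
      exact ⟨e, he, _, ⟨c, hc, rfl⟩, rfl⟩
    · rintro ⟨e, he, q, ⟨c, hc, rfl⟩, rfl⟩
      exact ⟨e, he, c, hc, rfl⟩

/-- **IUTchI:Def6.4(iii)** (kurims p.163) **Every representative IS an isomorphism of `𝒟-Θ^{±ell}`-Hodge theaters in the printed sense**
(abc-iut-L5-t4's `DThetaPMEllHT.Iso`): the pair (`toPMIso`, `toEllIso`) has the same index bijection and "induce[s] the
same poly-isomorphism between the respective capsules of `𝒟`-prime-strips". ([IUTchI] Def 6.4 (iii) p.163) [claim: Mochizuki2012, status: disputed] -/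
def toIso (f : DRepIso H₁ H₂) : DThetaPMEllHT.Iso H₁ H₂ where
  pmIso := f.toPMIso
  ellIso := f.toEllIso
  index_eq _ := rfl
  caps_eq t p := by
    dsimp only [toPMIso, toEllIso, DThetaPMEllHT.pmBridge, DThetaPMEllHT.ellBridge]
    simp only [eqToIso_refl, Iso.trans_refl]
    exact Iff.rfl

/-- **IUTchI:Def6.4(iii)** (kurims p.163) The index bijection of the printed isomorphism is the representative's `ι`. ([IUTchI] Def 6.4 (iii) p.163) [claim: Mochizuki2012, status: disputed] -/
@[simp] theorem toIso_indexEquiv (f : DRepIso H₁ H₂) : f.toIso.pmIso.indexEquiv = f.ι := rfl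

/-- **IUTchI:Def6.4(iii)** (kurims p.163) Its `+`-full poly-isomorphism `†𝔇_≻ ⥲ ‡𝔇_≻` is the `Aut_+(‡𝔇_≻)`-orbit of the representative's
`cod` ("obtained as the `Aut_+(−)`-orbit of an isomorphism", Def 6.1 (iv)). ([IUTchI] Def 6.1 (iv) p.157) [claim: Mochizuki2012, status: disputed] -/
@[simp] theorem toIso_codPoly (f : DRepIso H₁ H₂) : f.toIso.pmIso.codPoly = DStrip.plusFullPolyIso f.cod := rfl

/-- **IUTchI:Def6.4(iii)** (kurims p.163) Two representatives determine the SAME printed isomorphism iff they have the same index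
bijection and their `†𝔇_≻ ⥲ ‡𝔇_≻` lie in the same `+`-full orbit (abc-iut-L5-t13's rigidity
`DThetaPMBridge.Iso.eq_of_indexEquiv_eq`: the capsule constituents are forced) — the `Θ^±`-bridge part.
([IUTchI] Def 6.4 (i) p.162) [claim: Mochizuki2012, status: disputed] -/
theorem toPMIso_eq_iff (f g : DRepIso H₁ H₂) :
    f.toPMIso = g.toPMIso ↔ f.ι = g.ι ∧ ∀ v, K.labMap v (f.cod v) = K.labMap v (g.cod v) := by
  constructor
  · intro h
    refine ⟨congrArg DThetaPMBridge.Iso.indexEquiv h, ?_⟩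
    have hc : DStrip.plusFullPolyIso f.cod = DStrip.plusFullPolyIso g.cod := congrArg DThetaPMBridge.Iso.codPoly h
    exact DStrip.plusFullPolyIso_eq_iff.mp hc
  · rintro ⟨hι, hlab⟩
    exact DThetaPMBridge.Iso.eq_of_indexEquiv_eq _ _ hι (DStrip.plusFullPolyIso_eq_iff.mpr hlab)

/-! ### Any two `𝒟-Θ^{±ell}`-Hodge theaters are isomorphic -/

/-- **IUTchI:Def6.4(iii)** (kurims p.163) `†φ^{Θ±}_t` transported along `t = t'` (pre-composition with the positive `+`-full orbit of
the transport isomorphism). ([IUTchI] Def 6.4 (i) p.162) [claim: Mochizuki2012, status: disputed] -/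
theorem polyPM_eq_polyComp_capsCast (H : K.DThetaPMEllHT) {t t' : H.T} (h : t = t') :
    H.polyPM t = DStrip.polyComp (DStrip.plusFullPolyIso (capsCast H h)) (H.polyPM t') := by
  subst h
  exact (H.polyComp_positive_polyPM t).symm

/-- **IUTchI:Def6.4(iii)** (kurims p.163) **Construction: a representative between ANY two `𝒟-Θ^{±ell}`-Hodge theaters**, assembled from
their structure isomorphisms with the model `(𝔇_≻ ⟵ 𝔇_± ⟶ 𝒟^{⊚±})` of Examples 6.2 (i), 6.3 (i) (field `exists_model`):
`ι := ι₁⁻¹ ∘ ι₂`, `caps_t := α₁⁻¹ ∘ α₂`, `cod := β₁⁻¹ ∘ β₂`, `glob := γ₁⁻¹ ∘ γ₂`. ([IUTchI] Def 6.4 (iii) p.163) [claim: Mochizuki2012, status: disputed] -/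
theorem iso_nonempty (H₁ H₂ : K.DThetaPMEllHT) : Nonempty (DRepIso H₁ H₂) := by
  obtain ⟨ι₁, hι₁, α₁, β₁, γ₁, hPM₁, hEll₁⟩ := H₁.exists_model
  obtain ⟨ι₂, hι₂, α₂, β₂, γ₂, hPM₂, hEll₂⟩ := H₂.exists_model
  refine ⟨ofTransport (ι₁.symm.trans ι₂) (fun e he => ?_)
    (fun t => (capsCast H₁ (ι₁.apply_symm_apply t)).symm.trans
      (((α₁ (ι₁.symm t)).symm).trans (α₂ (ι₁.symm t))))
    (β₁.symm.trans β₂) (γ₁.symm ≪≫ γ₂) (fun t => ?_) (fun t v g => ?_)⟩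
  · rw [Equiv.trans_assoc]
    exact isIso_symm _ _ hι₁ _ (hι₂ e he)
  · -- Def 6.4 (i) compatibility: both `†φ^{Θ±}`, `‡φ^{Θ±}` are conjugates of the model's positive orbit
    have h₂ := hPM₂ (ι₁.symm t)
    have h₁ := hPM₁ (ι₁.symm t)
    rw [Ex62.poly_eq, DStrip.polyConj_plusFullPolyIso] at h₁ h₂
    show DStrip.polyComp (DStrip.plusFullPolyIso ((capsCast H₁ (ι₁.apply_symm_apply t)).symm.trans
        (((α₁ (ι₁.symm t)).symm).trans (α₂ (ι₁.symm t))))) (H₂.polyPM (ι₂ (ι₁.symm t))) =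
      DStrip.polyComp (H₁.polyPM t) (DStrip.plusFullPolyIso (β₁.symm.trans β₂))
    rw [h₂, polyPM_eq_polyComp_capsCast H₁ (ι₁.apply_symm_apply t).symm, h₁, DStrip.polyComp_plusFullPolyIso,
      DStrip.polyComp_plusFullPolyIso, DStrip.polyComp_plusFullPolyIso]
    congr 1
    funext v
    ext
    simp [DStrip.Iso.trans, DStrip.Iso.symm, DStrip.Iso.refl, capsCast]
  · -- Def 6.4 (ii) compatibility in transport form: conjugation moves the model `φ^{Θell}` between the two
    have h₂ := hEll₂ (ι₁.symm t) v
    have h₁ := hEll₁ (ι₁.symm t) v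
    show g ∈ H₂.polyEll (ι₂ (ι₁.symm t)) v ↔ ((capsCast H₁ (ι₁.apply_symm_apply t)).symm.trans
        (((α₁ (ι₁.symm t)).symm).trans (α₂ (ι₁.symm t))) v).hom ≫ g ≫ (K.atV v).map (γ₁.symm ≪≫ γ₂).inv ∈
      H₁.polyEll t v
    have e1 : ((capsCast H₁ (ι₁.apply_symm_apply t)).symm.trans
        (((α₁ (ι₁.symm t)).symm).trans (α₂ (ι₁.symm t))) v).hom ≫ g ≫ (K.atV v).map (γ₁.symm ≪≫ γ₂).inv =
        (capsCast H₁ (ι₁.apply_symm_apply t).symm v).hom ≫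
          ((α₁ (ι₁.symm t) v).inv ≫ (α₂ (ι₁.symm t) v).hom ≫ g ≫ (K.atV v).map γ₂.inv ≫ (K.atV v).map γ₁.hom) := by
      simp [DStrip.Iso.trans, DStrip.Iso.symm, capsCast, Functor.map_comp]
    rw [e1, polyEll_capsCast_iff, h₁, h₂]
    simp only [ellConj, Set.mem_setOf_eq]
    constructor
    · rintro ⟨e, he, rfl⟩
      exact ⟨e, he, by simp⟩
    · rintro ⟨e, he, hk⟩
      refine ⟨e, he, ?_⟩
      have hk' := (cancel_epi _).mp hk
      have hk'' : ((α₂ (ι₁.symm t) v).hom ≫ g ≫ (K.atV v).map γ₂.inv) ≫ (K.atV v).map γ₁.hom =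
          e ≫ (K.atV v).map γ₁.hom := by simpa only [Category.assoc] using hk'
      have hk3 := (cancel_mono _).mp hk''
      rw [← hk3]
      simp

end DRepIso

/-- **IUTchI:Def6.4(iii)** (kurims p.163) Any two objects of `DHTRep K` are isomorphic — the `StripFrame.iso_nonempty_DHT` shape
([IUTchI] Rmk 6.12.2 (ii) p.174: all `𝒟-Θ^{±ell}NF`-Hodge theaters are isomorphic; here the `𝒟-Θ^{±ell}` part).
([IUTchI] Def 6.4 (iii) p.163) [claim: Mochizuki2012, status: disputed] -/
theorem iso_nonempty (X Y : DHTRep K) : Nonempty (X ≅ Y) := by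
  obtain ⟨f⟩ := DRepIso.iso_nonempty X.out Y.out
  exact ⟨Groupoid.isoEquivHom X Y |>.symm f⟩

/-! ### The strip projections as functors -/

/-- **IUTchIII:Prop1.3(i)** (kurims p.42) `†ℋ𝒯^{𝒟-Θ±ell} ↦ †𝔇_≻`: the `𝒟`-prime-strip labelled `≻` of a `𝒟`-Hodge theater,
FUNCTORIALLY in (single) isomorphisms — into abc-iut-L6-t7's groupoid of `𝒟`-prime-strips (`Hom := DStrip.Iso`); the
`StripFrame.dstrip ≻` shape ("the poly-isomorphism determined by `Ξ` between the `𝒟`-prime-strips associated to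
`†𝔉_□`, `‡𝔉_□`", here for single `Ξ` per Rmk 1.3.1). ([IUTchIII] Prop 1.3 (i) p.42) [claim: Mochizuki2012, status: disputed] -/
def codFunctor : DHTRep K ⥤ K.DStrip where
  obj X := X.out.codomain
  map f := f.cod
  map_id _ := rfl
  map_comp _ _ := rfl

/-- **IUTchIII:Prop1.3(i)** (kurims p.42) `†ℋ𝒯^{𝒟-Θ±ell} ↦ †𝒟^{⊚±}`: the global object of the `Θ^{ell}`-bridge, functorially in single
isomorphisms. ([IUTchIII] Prop 1.3 (i) p.42) [claim: Mochizuki2012, status: disputed] -/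
def globFunctor : DHTRep K ⥤ K.Glob where
  obj X := X.out.glob
  map f := f.glob.hom
  map_id _ := rfl
  map_comp _ _ := rfl

/-- **IUTchIII:Prop1.3(i)** (kurims p.42) On morphisms `codFunctor` is the representative's `†𝔇_≻ ⥲ ‡𝔇_≻`. ([IUTchIII] Prop 1.3 (i) p.42) [claim: Mochizuki2012, status: disputed] -/
@[simp] theorem codFunctor_map {X Y : DHTRep K} (f : X ⟶ Y) : codFunctor.map f = f.cod := rfl

end DHTRep

end Literature.IUT.LogThetaLattice
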